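import Literature.Computability.Complexity.StackArith
import Literature.Computability.Complexity.TautCertificates
import HarnessLib

/-!
# String routines for structured stack programs

Trunk `CplxCore`, toolkit continuing `StackPrograms.lean` (`Com`, `Runs`) and the generic
register utilities of `StackArith.lean` (`clear`, `pour`, `move`, `copy`, `flag`):

* a generic **invariant rule** for loops whose body leaves the loop register alone
  (`Com.runs_loop_of_inv`, functional semantics `Com.loopIter`), so that a loop is verified by
  one lemma about its body instead of an induction over configurations;
* flag registers (`flag`): branching `Com.ifFlag`, conjunction `Com.andFlag`;
* destructive **string equality** `Com.eqCheck` (`runs_eqCheck`: flag `decide (u = v)`);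
* the self-delimiting **pair decoder** `boolUnpair` (`BoolEncodings.lean`) as a five-register
  finite-state loop `Com.unpair` (`runs_unpair`, linear time, total: malformed inputs give the
  same junk as `boolUnpair`), together with the well-formedness test `wellPaired`
  (`wellPaired_iff`: membership in the range of `boolPair`) delivered as a flag
  (`Com.unpairW`, `runs_unpairW`);
* constant-time peeks: `Com.peekCanon` (is the numeral whose *reversal* is on the register a
  canonical numeral, `IsCanonicalNum` of `TautCertificates.lean`) and `Com.peekTwo` (has the
  register at least two bits).

Every routine is parametric in the register names (with distinctness hypotheses) and comes with
an exact final register file and a linear cost bound; these are the parsing primitives of input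
decoders for `boolPair`/`encodeNat`-coded tuples (e.g. the post-processor of Shor's order
finding, `ShorAssembly.lean`).

## References

* S. Arora, B. Barak, *Computational Complexity: A Modern Approach*, CUP 2009, §0.1 (pairing
  of strings), §1.3 (robustness of polynomial time).
* T. Nipkow, G. Klein, *Concrete Semantics with Isabelle/HOL*, Springer 2014, §7.2 and
  Lemma 12.4 (invariant/while rule of big-step and Hoare-style reasoning).
-/

namespace Literature.Computability.Complexity

open _root_.Computability

namespace Com

variable {ι : Type} [DecidableEq ι]

/-! ### Loops whose body leaves the loop register alone -/

/-- Functional semantics of `loop k ct cf` when the iteration on bit `b` transforms the (already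
popped) register file by `f b`. [folklore] -/
def loopIter (k : ι) (f : Bool → Regs ι → Regs ι) : List Bool → Regs ι → Regs ι
  | [], R => R
  | b :: w, R => loopIter k f w (f b (Function.update R k w))

/-- `loopIter` on the empty loop register. [folklore] -/
@[simp] theorem loopIter_nil (k : ι) (f : Bool → Regs ι → Regs ι) (R : Regs ι) :
    loopIter k f [] R = R := rfl

/-- `loopIter` unrolled once. [folklore] -/
@[simp] theorem loopIter_cons (k : ι) (f : Bool → Regs ι → Regs ι) (b : Bool) (w : List Bool)
    (R : Regs ι) : loopIter k f (b :: w) R = loopIter k f w (f b (Function.update R k w)) := rfl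

/-- **Invariant rule for loops.** If from every register file satisfying the invariant `I` whose
loop register holds `b :: w`, the body for `b` runs (after the pop) to `f b _` within budget `B`,
re-establishing `I` and leaving `w` in the loop register, then the loop runs to `loopIter` within
`|w| (B + 2) + 1`. [Nipkow–Klein 2014, §7.2 and Lemma 12.4 (while rule)] [folklore] -/
theorem runs_loop_of_inv {k : ι} {ct cf : Com ι} (f : Bool → Regs ι → Regs ι)
    (I : Regs ι → Prop) (B : ℕ)
    (hbody : ∀ (b : Bool) (w : List Bool) (R : Regs ι), I R → R k = b :: w →
      Runs (bif b then ct else cf) (Function.update R k w) (f b (Function.update R k w)) B ∧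
        I (f b (Function.update R k w)) ∧ f b (Function.update R k w) k = w)
    (w : List Bool) (R : Regs ι) (hI : I R) (hk : R k = w) :
    Runs (loop k ct cf) R (loopIter k f w R) (w.length * (B + 2) + 1) := by
  induction w generalizing R with
  | nil => simpa using Runs.loop_nil ct cf hk
  | cons b w ih =>
    obtain ⟨hr, hI', hk'⟩ := hbody b w R hI hk
    have h2 := ih _ hI' hk'
    have hcost : (b :: w).length * (B + 2) + 1 = B + 2 + (w.length * (B + 2) + 1) := by
      simp only [List.length_cons]; ring
    rw [loopIter_cons, hcost]
    cases b with
    | true => exact Runs.loop_true hk hr h2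
    | false => exact Runs.loop_false hk hr h2

/-- The invariant rule without invariant. [folklore] -/
theorem runs_loop_of_fun {k : ι} {ct cf : Com ι} (f : Bool → Regs ι → Regs ι) (B : ℕ)
    (hbody : ∀ (b : Bool) (w : List Bool) (R : Regs ι), R k = b :: w →
      Runs (bif b then ct else cf) (Function.update R k w) (f b (Function.update R k w)) B ∧
        f b (Function.update R k w) k = w)
    (w : List Bool) (R : Regs ι) (hk : R k = w) :
    Runs (loop k ct cf) R (loopIter k f w R) (w.length * (B + 2) + 1) :=
  runs_loop_of_inv f (fun _ => True) B
    (fun b w R _ hk => ⟨(hbody b w R hk).1, trivial, (hbody b w R hk).2⟩) w R trivial hk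

/-! ### Flags -/

/-- A flag register holds at most one bit. [folklore] -/
theorem length_flag_le (b : Bool) : (flag b).length ≤ 1 := by cases b <;> simp

/-- Branch on a flag register `F` (restoring it): run `c₁` if it holds `true`, `c₂` if `false`.
[folklore] -/
def ifFlag (F : ι) (c₁ c₂ : Com ι) : Com ι := pop F (push F true ;; c₁) c₂ c₂

/-- `ifFlag` on `true`. [folklore] -/
theorem runs_ifFlag_true {F : ι} {c₁ : Com ι} (c₂ : Com ι) {R R' : Regs ι} {B : ℕ}
    (hF : R F = flag true) (h : Runs c₁ R R' B) : Runs (ifFlag F c₁ c₂) R R' (B + 3) := by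
  have h1 : Runs (push F true) (Function.update R F []) R 1 :=
    Runs.push' (by
      rw [Function.update_self, Function.update_idem]
      rw [flag_true] at hF
      rw [← hF, Function.update_eq_self])
  have := Runs.pop_true c₂ c₂ (w := []) (by simpa using hF) (h1.seq h)
  exact this.mono (by omega)

/-- `ifFlag` on `false`. [folklore] -/
theorem runs_ifFlag_false {F : ι} (c₁ : Com ι) {c₂ : Com ι} {R R' : Regs ι} {B : ℕ}
    (hF : R F = flag false) (h : Runs c₂ R R' B) : Runs (ifFlag F c₁ c₂) R R' (B + 3) :=
  (Runs.pop_nil _ c₂ (by simpa using hF) h).mono (by omega)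

/-- `ifFlag`, both cases. [folklore] -/
theorem runs_ifFlag {F : ι} {c₁ c₂ : Com ι} {b : Bool} {R R' : Regs ι} {B : ℕ}
    (hF : R F = flag b) (h₁ : b = true → Runs c₁ R R' B) (h₂ : b = false → Runs c₂ R R' B) :
    Runs (ifFlag F c₁ c₂) R R' (B + 3) := by
  cases b with
  | true => exact runs_ifFlag_true c₂ hF (h₁ rfl)
  | false => exact runs_ifFlag_false c₁ hF (h₂ rfl)

/-- `clear` on a register of length `≤ 1` (a flag). [folklore] -/
theorem runs_clear_flag (k : ι) {R : Regs ι} (h : (R k).length ≤ 1) :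
    Runs (clear k) R (Function.update R k []) 3 :=
  (runs_clear k R).mono (by omega)

omit [DecidableEq ι] in
/-- Symmetry of `≠` (term form). [folklore] -/
private theorem ne_comm' {a b : ι} (h : a ≠ b) : b ≠ a := fun e => h e.symm


/-! ### String equality -/

/-- Destructive equality test of registers `a` and `b` into the flag register `F`. [folklore] -/
def eqCheck (a b F : ι) : Com ι :=
  clear F ;; push F true ;;
  loop a (pop b skip (clear F) (clear F)) (pop b (clear F) skip (clear F)) ;;
  pop b (clear F ;; clear b) (clear F ;; clear b) skip

/-- One comparison step of `eqCheck` (functional form). [folklore] -/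
private def eqStep (b F : ι) (x : Bool) (R : Regs ι) : Regs ι :=
  match R b with
  | [] => Function.update R F []
  | y :: ys =>
    if x = y then Function.update R b ys else Function.update (Function.update R b ys) F []

/-- Functional semantics of the comparison loop of `eqCheck`. [folklore] -/
private theorem eqStep_loopIter {a b F : ι} (hab : a ≠ b) (haF : a ≠ F) (hbF : b ≠ F) :
    ∀ (u v : List Bool) (c : Bool) (R : Regs ι), R a = u → R b = v → R F = flag c →
      loopIter a (eqStep b F) u R =
        Function.update (Function.update (Function.update R a []) b (v.drop u.length)) F
          (flag (c && decide (v.take u.length = u))) := by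
  intro u
  induction u with
  | nil =>
    intro v c R ha hb hF
    have h0 : Function.update R a [] = R := by rw [← ha]; exact Function.update_eq_self a R
    simp only [loopIter_nil, List.length_nil, List.drop_zero, List.take_zero, decide_true,
      Bool.and_true, h0]
    rw [← hb, Function.update_eq_self, ← hF, Function.update_eq_self]
  | cons x u ih =>
    intro v c R ha hb hF
    rw [loopIter_cons]
    cases v with
    | nil =>
      have hstep : eqStep b F x (Function.update R a u) =
          Function.update (Function.update R a u) F [] := by
        simp [eqStep, Function.update_of_ne (ne_comm' hab), hb]
      rw [hstep, ih [] false _ (by simp [Function.update_of_ne haF])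
        (by simp [Function.update_of_ne hbF, Function.update_of_ne (ne_comm' hab), hb])
        (by simp)]
      funext i
      by_cases hiF : i = F
      · subst hiF; simp
      · by_cases hib : i = b
        · subst hib; simp [Function.update_of_ne hiF]
        · by_cases hia : i = a
          · subst hia; simp [Function.update_of_ne hiF, Function.update_of_ne hib]
          · simp [Function.update_of_ne hiF, Function.update_of_ne hib, Function.update_of_ne hia]
    | cons y ys =>
      by_cases hxy : x = y
      · subst hxy
        have hstep : eqStep b F x (Function.update R a u) =
            Function.update (Function.update R a u) b ys := by
          simp [eqStep, Function.update_of_ne (ne_comm' hab), hb]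
        rw [hstep, ih ys c _ (by simp [Function.update_of_ne hab])
          (by simp) (by simp [Function.update_of_ne (ne_comm' hbF), Function.update_of_ne (ne_comm' haF), hF])]
        funext i
        by_cases hiF : i = F
        · subst hiF; simp
        · by_cases hib : i = b
          · subst hib; simp [Function.update_of_ne hiF]
          · by_cases hia : i = a
            · subst hia; simp [Function.update_of_ne hiF, Function.update_of_ne hib]
            · simp [Function.update_of_ne hiF, Function.update_of_ne hib, Function.update_of_ne hia]
      · have hstep : eqStep b F x (Function.update R a u) =
            Function.update (Function.update (Function.update R a u) b ys) F [] := by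
          simp [eqStep, Function.update_of_ne (ne_comm' hab), hb, hxy]
        rw [hstep, ih ys false _ (by simp [Function.update_of_ne haF, Function.update_of_ne hab])
          (by simp [Function.update_of_ne hbF]) (by simp)]
        have hne : ¬ (y :: List.take u.length ys = x :: u) := by
          intro e; exact hxy (List.cons.inj e).1.symm
        funext i
        by_cases hiF : i = F
        · subst hiF; simp [hne]
        · by_cases hib : i = b
          · subst hib; simp [Function.update_of_ne hiF]
          · by_cases hia : i = a
            · subst hia; simp [Function.update_of_ne hiF, Function.update_of_ne hib]
            · simp [Function.update_of_ne hiF, Function.update_of_ne hib, Function.update_of_ne hia]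

/-- `eqCheck a b F` empties `a` and `b` and leaves `flag (u = v)` in `F`, at cost
`≤ 2|F| + 7|u| + 2|v| + 9`. [folklore] -/
theorem runs_eqCheck {a b F : ι} (hab : a ≠ b) (haF : a ≠ F) (hbF : b ≠ F) (R : Regs ι) :
    Runs (eqCheck a b F) R
      (Function.update (Function.update (Function.update R a []) b []) F
        (flag (decide (R a = R b))))
      ((R F).length * 2 + (R a).length * 7 + (R b).length * 2 + 9) := by
  -- initialise the flag
  have i1 := runs_clear F R
  have i2 : Runs (push F true) (Function.update R F []) (Function.update R F (flag true)) 1 :=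
    Runs.push' (by simp)
  set R₁ := Function.update R F (flag true) with hR₁
  -- the loop
  have hl := runs_loop_of_inv (k := a) (ct := pop b skip (clear F) (clear F))
    (cf := pop b (clear F) skip (clear F)) (eqStep b F) (fun S => (S F).length ≤ 1) 5
    (fun x w S hS hk => by
      refine ⟨?_, ?_, ?_⟩
      · rcases hSb : S b with _ | ⟨y, ys⟩
        · have e : eqStep b F x (Function.update S a w) =
              Function.update (Function.update S a w) F [] := by
            simp [eqStep, Function.update_of_ne (ne_comm' hab), hSb]
          rw [e]
          have hc := runs_clear_flag F (R := Function.update S a w)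
            (by simpa [Function.update_of_ne (ne_comm' haF)] using hS)
          cases x
          · exact (Runs.pop_nil _ _ (by simp [Function.update_of_ne (ne_comm' hab), hSb]) hc).mono
              (by omega)
          · exact (Runs.pop_nil _ _ (by simp [Function.update_of_ne (ne_comm' hab), hSb]) hc).mono
              (by omega)
        · have hbk : Function.update S a w b = y :: ys := by
            simp [Function.update_of_ne (ne_comm' hab), hSb]
          by_cases hxy : x = y
          · subst hxy
            have e : eqStep b F x (Function.update S a w) =
                Function.update (Function.update S a w) b ys := by
              simp [eqStep, Function.update_of_ne (ne_comm' hab), hSb]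
            rw [e]
            cases x
            · exact (Runs.pop_false _ _ hbk (Runs.skip _)).mono (by omega)
            · exact (Runs.pop_true _ _ hbk (Runs.skip _)).mono (by omega)
          · have e : eqStep b F x (Function.update S a w) =
                Function.update (Function.update (Function.update S a w) b ys) F [] := by
              simp [eqStep, Function.update_of_ne (ne_comm' hab), hSb, hxy]
            rw [e]
            have hc := runs_clear_flag F (R := Function.update (Function.update S a w) b ys)
              (by simpa [Function.update_of_ne (ne_comm' hbF), Function.update_of_ne (ne_comm' haF)] using hS)
            cases x
            · cases y
              · exact absurd rfl hxy
              · exact (Runs.pop_true _ _ hbk hc).mono (by omega)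
            · cases y
              · exact (Runs.pop_false _ _ hbk hc).mono (by omega)
              · exact absurd rfl hxy
      · rcases hSb : S b with _ | ⟨y, ys⟩
        · simp [eqStep, Function.update_of_ne (ne_comm' hab), hSb]
        · by_cases hxy : x = y
          · simpa [eqStep, Function.update_of_ne (ne_comm' hab), hSb, hxy,
              Function.update_of_ne (ne_comm' hbF), Function.update_of_ne (ne_comm' haF)] using hS
          · simp [eqStep, Function.update_of_ne (ne_comm' hab), hSb, hxy]
      · rcases hSb : S b with _ | ⟨y, ys⟩
        · simp [eqStep, Function.update_of_ne (ne_comm' hab), hSb, Function.update_of_ne haF]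
        · by_cases hxy : x = y
          · simp [eqStep, Function.update_of_ne (ne_comm' hab), hSb, hxy, Function.update_of_ne hab]
          · simp [eqStep, Function.update_of_ne (ne_comm' hab), hSb, hxy, Function.update_of_ne hab,
              Function.update_of_ne haF])
    (R a) R₁ (by simp [hR₁]) (by simp [hR₁, Function.update_of_ne haF])
  rw [eqStep_loopIter hab haF hbF (R a) (R b) true R₁ (by simp [hR₁, Function.update_of_ne haF])
    (by simp [hR₁, Function.update_of_ne hbF]) (by simp [hR₁])] at hl
  simp only [Bool.true_and] at hl
  set R₂ := Function.update (Function.update (Function.update R₁ a []) b ((R b).drop (R a).length)) F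
    (flag (decide ((R b).take (R a).length = R a))) with hR₂
  -- the final test
  have hfin : Runs (pop b (clear F ;; clear b) (clear F ;; clear b) skip) R₂
      (Function.update (Function.update (Function.update R a []) b []) F (flag (decide (R a = R b))))
      ((R b).length * 2 + 6) := by
    rcases hd : (R b).drop (R a).length with _ | ⟨y, ys⟩
    · have hlen : (R b).length ≤ (R a).length := List.drop_eq_nil_iff.1 hd
      have htake : (R b).take (R a).length = R b := List.take_of_length_le hlen
      have hiff : ((R b).take (R a).length = R a) ↔ (R a = R b) := by rw [htake]; exact eq_comm
      refine (Runs.pop_nil _ _ (by simp [hR₂, Function.update_of_ne hbF, hd]) (Runs.skip _)).mono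
        (by omega) |>.congr ?_
      rw [hR₂, hd]
      funext i
      by_cases hiF : i = F
      · subst hiF; simp [hiff, hR₁]
      · by_cases hib : i = b
        · subst hib; simp [Function.update_of_ne hiF]
        · by_cases hia : i = a
          · subst hia; simp [Function.update_of_ne hiF, Function.update_of_ne hib]
          · simp [Function.update_of_ne hiF, Function.update_of_ne hib, Function.update_of_ne hia, hR₁]
    · have hne : ¬ (R a = R b) := by
        intro e
        rw [e, List.drop_length] at hd
        exact List.cons_ne_nil _ _ hd.symm
      have hbk : R₂ b = y :: ys := by simp [hR₂, Function.update_of_ne hbF, hd]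
      have hc1 := runs_clear_flag F (R := Function.update R₂ b ys)
        (by simp [Function.update_of_ne (ne_comm' hbF), hR₂]; exact length_flag_le _)
      have hc2 := runs_clear b (Function.update (Function.update R₂ b ys) F [])
      have hys : ys.length + 1 ≤ (R b).length := by
        have := congrArg List.length hd
        simp at this; omega
      have hrun := hc1.seq hc2
      have hfinal : Function.update (Function.update (Function.update R₂ b ys) F []) b [] =
          Function.update (Function.update (Function.update R a []) b []) F
            (flag (decide (R a = R b))) := by
        rw [hR₂]
        funext i
        by_cases hiF : i = F
        · subst hiF; simp [Function.update_of_ne (ne_comm' hbF), hne]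
        · by_cases hib : i = b
          · subst hib; simp [Function.update_of_ne hbF]
          · by_cases hia : i = a
            · subst hia; simp [Function.update_of_ne hiF, Function.update_of_ne hib]
            · simp [Function.update_of_ne hiF, Function.update_of_ne hib, Function.update_of_ne hia, hR₁]
      rw [hfinal] at hrun
      have hcost : 3 + (2 * ((Function.update (Function.update R₂ b ys) F []) b).length + 1) ≤
          (R b).length * 2 + 4 := by
        simp [Function.update_of_ne hbF]; omega
      cases y
      · exact (Runs.pop_false _ _ hbk (hrun.mono hcost)).mono (by omega)
      · exact (Runs.pop_true _ _ hbk (hrun.mono hcost)).mono (by omega)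
  refine (i1.seq (i2.seq (hl.seq hfin))).mono ?_
  omega

end Com

/-! ### Well-formed pairs and canonical numerals (pure facts) -/

/-- Two bits of `boolUnpair`. [folklore] -/
theorem boolUnpair_cons_cons (b b' : Bool) (rest : List Bool) :
    boolUnpair (b :: b' :: rest) =
      if b = b' then (b :: (boolUnpair rest).1, (boolUnpair rest).2)
      else if b' = true then ([], rest) else ([], []) := by
  rw [boolUnpair]

/-- `boolUnpair` of a single bit is junk. [folklore] -/
theorem boolUnpair_singleton (b : Bool) : boolUnpair [b] = ([], []) := by
  cases b <;> rfl

/-- `boolPair` of a nonempty first component, two bits at a time. [folklore] -/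
theorem boolPair_cons (b : Bool) (x y : List Bool) :
    boolPair (b :: x) y = b :: b :: boolPair x y := by
  simp [boolPair]

/-- `boolPair` of an empty first component is the separator followed by the second. [folklore] -/
theorem boolPair_nil (y : List Bool) : boolPair [] y = false :: true :: y := by
  simp [boolPair]

/-- **Well-formedness test for the pairing** `boolPair`: reading the string two bits at a
time, pairs `bb` belong to the first component and the first unequal pair must be the
separator `01`. [cite: AroraBarak2009, §0.1 (pairing of strings)] -/
def wellPaired : List Bool → Bool
  | b :: b' :: rest => if b = b' then wellPaired rest else b'
  | _ => false

/-- The empty string is not a pair. [folklore] -/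
@[simp] theorem wellPaired_nil : wellPaired [] = false := rfl

/-- A single bit is not a pair. [folklore] -/
@[simp] theorem wellPaired_singleton (b : Bool) : wellPaired [b] = false := rfl

/-- Two bits of `wellPaired`. [folklore] -/
theorem wellPaired_cons_cons (b b' : Bool) (rest : List Bool) :
    wellPaired (b :: b' :: rest) = if b = b' then wellPaired rest else b' := rfl

/-- Pairs are well formed. [folklore] -/
theorem wellPaired_boolPair (x y : List Bool) : wellPaired (boolPair x y) = true := by
  induction x with
  | nil => rw [boolPair_nil, wellPaired_cons_cons]; simp
  | cons b x ih => rw [boolPair_cons, wellPaired_cons_cons, if_pos rfl, ih]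

/-- A well-formed string is the pair of its two components. [folklore] -/
theorem boolPair_boolUnpair : ∀ {w : List Bool}, wellPaired w = true →
    boolPair (boolUnpair w).1 (boolUnpair w).2 = w
  | [], h => by simp at h
  | [_], h => by simp at h
  | b :: b' :: rest, h => by
    rw [wellPaired_cons_cons] at h
    rw [boolUnpair_cons_cons]
    by_cases hbb : b = b'
    · subst hbb
      rw [if_pos rfl] at h ⊢
      rw [boolPair_cons, boolPair_boolUnpair h]
    · rw [if_neg hbb] at h ⊢
      subst h
      have hb : b = false := by cases b <;> simp_all
      subst hb
      rw [if_pos rfl, boolPair_nil]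

/-- **`wellPaired` decides the range of `boolPair`.** [cite: AroraBarak2009, §0.1 (pairing of strings)] -/
theorem wellPaired_iff (w : List Bool) : wellPaired w = true ↔ ∃ x y, w = boolPair x y :=
  ⟨fun h => ⟨_, _, (boolPair_boolUnpair h).symm⟩,
    by rintro ⟨x, y, rfl⟩; exact wellPaired_boolPair x y⟩

/-- Is the top bit `true` or the string empty?  For the *reversal* of a numeral `x` this is the
test "`x` is a canonical numeral" (`canonTop_reverse`). [folklore] -/
def canonTop : List Bool → Bool
  | [] => true
  | b :: _ => b

/-- `canonTop` of a reversed string decides `IsCanonicalNum`. [folklore] -/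
theorem canonTop_reverse (x : List Bool) : canonTop x.reverse = decide (IsCanonicalNum x) := by
  unfold IsCanonicalNum
  rcases x.eq_nil_or_concat with rfl | ⟨v, b, rfl⟩
  · simp [canonTop]
  · cases b <;> simp [canonTop]

namespace Com

variable {ι : Type} [DecidableEq ι]

/-! ### The pair decoder `boolUnpair` as a finite-state loop -/

omit [DecidableEq ι] in
/-- Distinctness of five register names from a `Nodup` certificate, in both orientations.
[folklore] -/
private theorem nodup₅ {k a t M P : ι} (h : [k, a, t, M, P].Nodup) :
    (k ≠ a ∧ k ≠ t ∧ k ≠ M ∧ k ≠ P ∧ a ≠ t ∧ a ≠ M ∧ a ≠ P ∧ t ≠ M ∧ t ≠ P ∧ M ≠ P) ∧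
    (a ≠ k ∧ t ≠ k ∧ M ≠ k ∧ P ≠ k ∧ t ≠ a ∧ M ≠ a ∧ P ≠ a ∧ M ≠ t ∧ P ≠ t ∧ P ≠ M) := by
  simp only [List.nodup_cons, List.mem_cons, not_or, List.not_mem_nil,
    not_false_eq_true, and_true, List.nodup_nil] at h
  obtain ⟨⟨hka, hkt, hkM, hkP⟩, ⟨hat, haM, haP⟩, ⟨htM, htP⟩, hMP⟩ := h
  exact ⟨⟨hka, hkt, hkM, hkP, hat, haM, haP, htM, htP, hMP⟩,
    ⟨Ne.symm hka, Ne.symm hkt, Ne.symm hkM, Ne.symm hkP, Ne.symm hat, Ne.symm haM, Ne.symm haP,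
      Ne.symm htM, Ne.symm htP, Ne.symm hMP⟩⟩

/-- The pair decoder `boolUnpair` as a finite-state loop over the input register `k`: the first
component is accumulated (reversed) on `a`, the second (reversed) on `t`; register `M` holds the
mode (`[]`: reading pairs; `[true]`: after the separator `01`, copying the second component;
`[false]`: after a malformed pair `10`, discarding the rest) and `P` the pending first bit of
the current pair. [cite: AroraBarak2009, §0.1 (pairing of strings)] -/
def unpair (k a t M P : ι) : Com ι :=
  loop k
    (pop M (push M true ;; push t true) (push M false)
      (pop P (push a true) (push M true) (push P true)))
    (pop M (push M true ;; push t false) (push M false)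
      (pop P (push M false) (push a false) (push P false)))

/-- One iteration of `unpair` on the bit `b` (functional form, on the popped register file).
[folklore] -/
def unpairStep (a t M P : ι) (b : Bool) (R : Regs ι) : Regs ι :=
  match R M with
  | true :: _ => Function.update R t (b :: R t)
  | false :: _ => R
  | [] =>
    match R P with
    | [] => Function.update R P (b :: R P)
    | b₀ :: p =>
      if b₀ = b then Function.update (Function.update R P p) a (b :: R a)
      else if b = true then Function.update (Function.update R P p) M (true :: R M)
      else Function.update (Function.update R P p) M (false :: R M)

/-- The loop body of `unpair` realises `unpairStep` within 5 steps. [folklore] -/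
private theorem runs_unpair_body {k a t M P : ι} (hd : [k, a, t, M, P].Nodup) (b : Bool)
    (w : List Bool) (S : Regs ι) (hk : S k = b :: w) :
    Runs (bif b then
        pop M (push M true ;; push t true) (push M false) (pop P (push a true) (push M true) (push P true))
      else
        pop M (push M true ;; push t false) (push M false) (pop P (push M false) (push a false) (push P false)))
      (Function.update S k w) (unpairStep a t M P b (Function.update S k w)) 5 ∧
    unpairStep a t M P b (Function.update S k w) k = w := by
  obtain ⟨⟨hka, hkt, hkM, hkP, hat, haM, haP, htM, htP, hMP⟩,
    ⟨hak, htk, hMk, hPk, hta, hMa, hPa, hMt, hPt, hPM⟩⟩ := nodup₅ hd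
  set R := Function.update S k w with hR
  have hRk : R k = w := by simp [hR]
  constructor
  · rcases hM : R M with _ | ⟨c, m⟩
    · -- pairing mode
      rcases hP : R P with _ | ⟨b₀, p⟩
      · have e : unpairStep a t M P b R = Function.update R P (b :: R P) := by
          simp [unpairStep, hM, hP]
        rw [e]
        cases b
        · exact (Runs.pop_nil _ _ hM (Runs.pop_nil _ _ hP (Runs.push P false R))).mono (by omega)
        · exact (Runs.pop_nil _ _ hM (Runs.pop_nil _ _ hP (Runs.push P true R))).mono (by omega)
      · by_cases hb : b₀ = b
        · subst hb
          have e : unpairStep a t M P b₀ R =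
              Function.update (Function.update R P p) a (b₀ :: R a) := by
            simp [unpairStep, hM, hP]
          rw [e]
          cases b₀
          · exact (Runs.pop_nil _ _ hM (Runs.pop_false _ _ hP
              (Runs.push' (by simp [haP])))).mono (by omega)
          · exact (Runs.pop_nil _ _ hM (Runs.pop_true _ _ hP
              (Runs.push' (by simp [haP])))).mono (by omega)
        · cases b
          · cases b₀
            · exact absurd rfl hb
            · have e : unpairStep a t M P false R =
                  Function.update (Function.update R P p) M (false :: R M) := by
                simp [unpairStep, hM, hP]
              rw [e]
              exact (Runs.pop_nil _ _ hM (Runs.pop_true _ _ hP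
                (Runs.push' (by simp [hMP])))).mono (by omega)
          · cases b₀
            · have e : unpairStep a t M P true R =
                  Function.update (Function.update R P p) M (true :: R M) := by
                simp [unpairStep, hM, hP]
              rw [e]
              exact (Runs.pop_nil _ _ hM (Runs.pop_false _ _ hP
                (Runs.push' (by simp [hMP])))).mono (by omega)
            · exact absurd rfl hb
    · cases c
      · -- junk mode
        have e : unpairStep a t M P b R = R := by simp [unpairStep, hM]
        rw [e]
        have hback : Function.update (Function.update R M m) M (false :: Function.update R M m M) = R := by
          rw [Function.update_self, Function.update_idem, ← hM, Function.update_eq_self]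
        cases b
        · exact (Runs.pop_false _ _ hM (Runs.push' hback)).mono (by omega)
        · exact (Runs.pop_false _ _ hM (Runs.push' hback)).mono (by omega)
      · -- copy mode
        have e : unpairStep a t M P b R = Function.update R t (b :: R t) := by simp [unpairStep, hM]
        rw [e]
        have hback : Function.update (Function.update R M m) M (true :: Function.update R M m M) = R := by
          rw [Function.update_self, Function.update_idem, ← hM, Function.update_eq_self]
        cases b
        · exact (Runs.pop_true _ _ hM ((Runs.push' hback).seq (Runs.push t false R))).mono (by omega)
        · exact (Runs.pop_true _ _ hM ((Runs.push' hback).seq (Runs.push t true R))).mono (by omega)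
  · rcases hM : R M with _ | ⟨c, m⟩
    · rcases hP : R P with _ | ⟨b₀, p⟩
      · simp [unpairStep, hM, hP, hkP, hRk]
      · by_cases hb : b₀ = b
        · simp [unpairStep, hM, hP, hb, hkP, hka, hRk]
        · cases b <;> simp [unpairStep, hM, hP, hb, hkP, hkM, hRk]
    · cases c
      · simp [unpairStep, hM, hRk]
      · simp [unpairStep, hM, hkt, hRk]

/-- `unpair` in copy mode appends the reversed input to `t`. [folklore] -/
private theorem loopIter_unpair_copy {k a t M P : ι} (hd : [k, a, t, M, P].Nodup) {m : List Bool} :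
    ∀ (w : List Bool) (R : Regs ι), R k = w → R M = true :: m →
      loopIter k (unpairStep a t M P) w R =
        Function.update (Function.update R k []) t (w.reverse ++ R t) := by
  obtain ⟨⟨hka, hkt, hkM, hkP, hat, haM, haP, htM, htP, hMP⟩,
    ⟨hak, htk, hMk, hPk, hta, hMa, hPa, hMt, hPt, hPM⟩⟩ := nodup₅ hd
  intro w
  induction w with
  | nil =>
    intro R hk hM
    have h0 : Function.update R k [] = R := by rw [← hk]; exact Function.update_eq_self k R
    rw [loopIter_nil, List.reverse_nil, List.nil_append, h0, Function.update_eq_self]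
  | cons b w ih =>
    intro R hk hM
    have e : unpairStep a t M P b (Function.update R k w) =
        Function.update (Function.update R k w) t (b :: R t) := by
      simp [unpairStep, hMk, hM, htk]
    rw [loopIter_cons, e, ih _ (by simp [hkt]) (by simp [hMt, hMk, hM])]
    funext i
    by_cases hit : i = t
    · subst hit; simp [*]
    · by_cases hik : i = k
      · subst hik; simp [*]
      · simp [*]

/-- `unpair` in junk mode discards the input. [folklore] -/
private theorem loopIter_unpair_junk {k a t M P : ι} (hd : [k, a, t, M, P].Nodup) {m : List Bool} :
    ∀ (w : List Bool) (R : Regs ι), R k = w → R M = false :: m →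
      loopIter k (unpairStep a t M P) w R = Function.update R k [] := by
  obtain ⟨⟨hka, hkt, hkM, hkP, hat, haM, haP, htM, htP, hMP⟩,
    ⟨hak, htk, hMk, hPk, hta, hMa, hPa, hMt, hPt, hPM⟩⟩ := nodup₅ hd
  intro w
  induction w with
  | nil =>
    intro R hk hM
    rw [loopIter_nil, ← hk, Function.update_eq_self]
  | cons b w ih =>
    intro R hk hM
    have e : unpairStep a t M P b (Function.update R k w) = Function.update R k w := by
      simp [unpairStep, hMk, hM]
    rw [loopIter_cons, e, ih _ (by simp) (by simp [hMk, hM]), Function.update_idem]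

/-- **Functional correctness of `unpair`** (from the pairing mode with nothing pending): the
loop leaves the two components of `boolUnpair w`, reversed, on top of `a` and `t`, at most one
bit in each of `M`, `P`, and `M = [true]` exactly when `w` is well formed. [folklore] -/
private theorem loopIter_unpair {k a t M P : ι} (hd : [k, a, t, M, P].Nodup) :
    ∀ (n : ℕ) (w : List Bool), w.length ≤ n → ∀ (R : Regs ι), R k = w → R M = [] → R P = [] →
      ∃ m p : List Bool, m.length ≤ 1 ∧ p.length ≤ 1 ∧ (m = [true] ↔ wellPaired w = true) ∧
        loopIter k (unpairStep a t M P) w R =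
          Function.update (Function.update (Function.update (Function.update (Function.update R k [])
            a ((boolUnpair w).1.reverse ++ R a)) t ((boolUnpair w).2.reverse ++ R t)) M m) P p := by
  obtain ⟨⟨hka, hkt, hkM, hkP, hat, haM, haP, htM, htP, hMP⟩,
    ⟨hak, htk, hMk, hPk, hta, hMa, hPa, hMt, hPt, hPM⟩⟩ := nodup₅ hd
  intro n
  induction n with
  | zero =>
    intro w hw R hk hM hP
    obtain rfl : w = [] := List.eq_nil_of_length_eq_zero (Nat.le_zero.1 hw)
    refine ⟨[], [], by simp, by simp, by simp, ?_⟩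
    rw [loopIter_nil]
    funext i
    by_cases hiP : i = P
    · subst hiP; simp [*]
    · by_cases hiM : i = M
      · subst hiM; simp [*]
      · by_cases hit : i = t
        · subst hit; simp [*, boolUnpair]
        · by_cases hia : i = a
          · subst hia; simp [*, boolUnpair]
          · by_cases hik : i = k
            · subst hik; simp [*]
            · simp [*]
  | succ n ih =>
    intro w hw R hk hM hP
    match w, hw, hk with
    | [], _, hk => exact ih [] (by simp) R hk hM hP
    | [b], _, hk =>
      refine ⟨[], [b], by simp, by simp, by simp, ?_⟩
      have e : unpairStep a t M P b (Function.update R k []) =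
          Function.update (Function.update R k []) P [b] := by
        simp [unpairStep, hMk, hM, hPk, hP]
      rw [loopIter_cons, loopIter_nil, e, boolUnpair_singleton]
      simp only [List.reverse_nil, List.nil_append]
      funext i
      by_cases hiP : i = P
      · subst hiP; simp [*]
      · by_cases hiM : i = M
        · subst hiM; simp [*]
        · by_cases hit : i = t
          · subst hit; simp [*]
          · by_cases hia : i = a
            · subst hia; simp [*]
            · by_cases hik : i = k
              · subst hik; simp [*]
              · simp [*]
    | b :: b' :: rest, hw, hk =>
      have hrest : rest.length ≤ n := by simp at hw; omega
      -- first bit: pending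
      have e1 : unpairStep a t M P b (Function.update R k (b' :: rest)) =
          Function.update (Function.update R k (b' :: rest)) P [b] := by
        simp [unpairStep, hMk, hM, hPk, hP]
      rw [loopIter_cons, e1, loopIter_cons, Function.update_comm hkP, Function.update_idem,
        boolUnpair_cons_cons]
      set R₁ := Function.update (Function.update R P [b]) k rest with hR₁
      have hR₁M : R₁ M = [] := by simp [hR₁, hMP, hMk, hM]
      have hR₁P : R₁ P = [b] := by simp [hR₁, hPk]
      have hR₁a : R₁ a = R a := by simp [hR₁, haP, hak]
      have hR₁t : R₁ t = R t := by simp [hR₁, htP, htk]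
      have hR₁k : R₁ k = rest := by simp [hR₁]
      by_cases hbb : b = b'
      · -- a complete pair
        subst hbb
        have e2 : unpairStep a t M P b R₁ = Function.update (Function.update R₁ P []) a (b :: R a) := by
          simp [unpairStep, hR₁M, hR₁P, hR₁a]
        rw [e2, if_pos rfl]
        set R₂ := Function.update (Function.update R₁ P []) a (b :: R a) with hR₂
        obtain ⟨m, p, hm, hp, hwp, hiter⟩ := ih rest hrest R₂ (by simp [hR₂, hka, hkP, hR₁k])
          (by simp [hR₂, hMa, hMP, hR₁M]) (by simp [hR₂, hPa])
        refine ⟨m, p, hm, hp, by rw [wellPaired_cons_cons, if_pos rfl]; exact hwp, ?_⟩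
        rw [hiter]
        simp only [List.reverse_cons, List.append_assoc, List.singleton_append]
        funext i
        by_cases hiP : i = P
        · subst hiP; simp [*]
        · by_cases hiM : i = M
          · subst hiM; simp [*]
          · by_cases hit : i = t
            · subst hit; simp [*]
            · by_cases hia : i = a
              · subst hia; simp [*]
              · by_cases hik : i = k
                · subst hik; simp [*]
                · simp [*]
      · rw [if_neg hbb]
        cases b' with
        | true =>
          -- separator `01`: copy mode
          have hb : b = false := by cases b; rfl; exact absurd rfl hbb
          have e2 : unpairStep a t M P true R₁ = Function.update (Function.update R₁ P []) M [true] := by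
            simp [unpairStep, hR₁M, hR₁P, hb]
          rw [e2, if_pos rfl]
          set R₂ := Function.update (Function.update R₁ P []) M [true] with hR₂
          refine ⟨[true], [], by simp, by simp, by simp [wellPaired_cons_cons, hb], ?_⟩
          rw [loopIter_unpair_copy hd (m := []) rest R₂ (by simp [hR₂, hkM, hkP, hR₁k]) (by simp [hR₂])]
          simp only [List.reverse_nil, List.nil_append]
          funext i
          by_cases hiP : i = P
          · subst hiP; simp [*]
          · by_cases hiM : i = M
            · subst hiM; simp [*]
            · by_cases hit : i = t
              · subst hit; simp [*]
              · by_cases hia : i = a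
                · subst hia; simp [*]
                · by_cases hik : i = k
                  · subst hik; simp [*]
                  · simp [*]
        | false =>
          -- malformed pair `10`: junk mode
          have hb : b = true := by cases b; exact absurd rfl hbb; rfl
          have e2 : unpairStep a t M P false R₁ = Function.update (Function.update R₁ P []) M [false] := by
            simp [unpairStep, hR₁M, hR₁P, hb]
          rw [e2]
          simp only [Bool.false_eq_true, ↓reduceIte]
          set R₂ := Function.update (Function.update R₁ P []) M [false] with hR₂
          refine ⟨[false], [], by simp, by simp, by simp [wellPaired_cons_cons, hb], ?_⟩
          rw [loopIter_unpair_junk hd (m := []) rest R₂ (by simp [hR₂, hkM, hkP, hR₁k]) (by simp [hR₂])]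
          simp only [List.reverse_nil, List.nil_append]
          funext i
          by_cases hiP : i = P
          · subst hiP; simp [*]
          · by_cases hiM : i = M
            · subst hiM; simp [*]
            · by_cases hit : i = t
              · subst hit; simp [*]
              · by_cases hia : i = a
                · subst hia; simp [*]
                · by_cases hik : i = k
                  · subst hik; simp [*]
                  · simp [*]

/-- **The pair decoder runs in linear time.** From the pairing mode (`M`, `P` empty),
`unpair k a t M P` empties `k = w` and leaves `(boolUnpair w).1` reversed on top of `a`,
`(boolUnpair w).2` reversed on top of `t`, and at most one bit in each of `M`, `P`, at cost
`7|w| + 1`. [cite: AroraBarak2009, §0.1 (pairing of strings)] -/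
theorem runs_unpair {k a t M P : ι} (hd : [k, a, t, M, P].Nodup) (R : Regs ι) (hM : R M = [])
    (hP : R P = []) :
    ∃ m p : List Bool, m.length ≤ 1 ∧ p.length ≤ 1 ∧ (m = [true] ↔ wellPaired (R k) = true) ∧
      Runs (unpair k a t M P) R
        (Function.update (Function.update (Function.update (Function.update (Function.update R k [])
          a ((boolUnpair (R k)).1.reverse ++ R a)) t ((boolUnpair (R k)).2.reverse ++ R t)) M m) P p)
        ((R k).length * 7 + 1) := by
  obtain ⟨m, p, hm, hp, hwp, hiter⟩ := loopIter_unpair hd (R k).length (R k) le_rfl R rfl hM hP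
  refine ⟨m, p, hm, hp, hwp, ?_⟩
  rw [← hiter]
  exact runs_loop_of_fun (unpairStep a t M P) 5 (fun b w S hk => runs_unpair_body hd b w S hk) (R k) R rfl

/-- The pair decoder with a well-formedness flag: `unpair`, then normalise the mode register
`M` to `flag (wellPaired w)` and empty `P`. [cite: AroraBarak2009, §0.1 (pairing of strings)] -/
def unpairW (k a t M P : ι) : Com ι :=
  unpair k a t M P ;; pop M (push M true) skip skip ;; clear P

/-- **The pair decoder with flag, in linear time**: from `M`, `P` empty, `unpairW k a t M P`
empties `k = w` and leaves `(boolUnpair w).1` reversed on top of `a`, `(boolUnpair w).2`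
reversed on top of `t`, `flag (wellPaired w)` in `M` and `P` empty, at cost `7|w| + 7`.
[cite: AroraBarak2009, §0.1 (pairing of strings)] -/
theorem runs_unpairW {k a t M P : ι} (hd : [k, a, t, M, P].Nodup) (R : Regs ι) (hM : R M = [])
    (hP : R P = []) :
    Runs (unpairW k a t M P) R
      (Function.update (Function.update (Function.update (Function.update (Function.update R k [])
        a ((boolUnpair (R k)).1.reverse ++ R a)) t ((boolUnpair (R k)).2.reverse ++ R t)) M
        (flag (wellPaired (R k)))) P [])
      ((R k).length * 7 + 7) := by
  obtain ⟨⟨hka, hkt, hkM, hkP, hat, haM, haP, htM, htP, hMP⟩,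
    ⟨hak, htk, hMk, hPk, hta, hMa, hPa, hMt, hPt, hPM⟩⟩ := nodup₅ hd
  obtain ⟨m, p, hm, hp, hwp, h1⟩ := runs_unpair hd R hM hP
  set R₁ := Function.update (Function.update (Function.update (Function.update
    (Function.update R k []) a ((boolUnpair (R k)).1.reverse ++ R a)) t
    ((boolUnpair (R k)).2.reverse ++ R t)) M m) P p with hR₁
  have hR₁M : R₁ M = m := by simp [hR₁, hMP]
  have hwf : m ≠ [true] → wellPaired (R k) = false := fun hne => by
    cases h : wellPaired (R k)
    · rfl
    · exact absurd (hwp.2 h) hne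
  have h2 : Runs (pop M (push M true) skip skip) R₁
      (Function.update R₁ M (flag (wellPaired (R k)))) 3 := by
    rcases m with _ | ⟨c, m'⟩
    · refine (Runs.pop_nil _ _ hR₁M (Runs.skip _)).of_eq ?_ (by omega)
      rw [hwf (by simp), flag_false, ← hR₁M, Function.update_eq_self]
    · obtain rfl : m' = [] := List.eq_nil_of_length_eq_zero (by
        simp only [List.length_cons] at hm; omega)
      cases c
      · refine (Runs.pop_false _ _ hR₁M (Runs.skip _)).of_eq ?_ (by omega)
        rw [hwf (by simp), flag_false]
      · refine (Runs.pop_true _ _ hR₁M (Runs.push' rfl)).of_eq ?_ (by omega)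
        rw [hwp.1 rfl, flag_true, Function.update_idem]
        simp
  set R₂ := Function.update R₁ M (flag (wellPaired (R k))) with hR₂
  have hR₂P : R₂ P = p := by simp [hR₂, hR₁, hPM]
  have h3 := runs_clear P R₂
  refine (h1.seq (h2.seq h3)).of_eq ?_ ?_
  · rw [hR₂, hR₁]
    funext i
    by_cases hiP : i = P
    · subst hiP; simp
    · rw [Function.update_of_ne hiP, Function.update_of_ne hiP]
      by_cases hiM : i = M
      · subst hiM; simp
      · rw [Function.update_of_ne hiM, Function.update_of_ne hiM, Function.update_of_ne hiP,
          Function.update_of_ne hiM]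
  · rw [hR₂P]; omega

/-! ### Constant-time peeks and flag conjunction -/

/-- `peekCanon a F`: set the flag `F` to `canonTop a` by peeking at the top bit of `a`
(restoring it). [folklore] -/
def peekCanon (a F : ι) : Com ι :=
  clear F ;; pop a (push a true ;; push F true) (push a false) (push F true)

/-- `peekCanon` computes `canonTop` in `7` steps. [folklore] -/
theorem runs_peekCanon {a F : ι} (haF : a ≠ F) (R : Regs ι) (hF : (R F).length ≤ 1) :
    Runs (peekCanon a F) R (Function.update R F (flag (canonTop (R a)))) 7 := by
  have h1 := runs_clear_flag F hF
  set R₁ := Function.update R F [] with hR₁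
  have hR₁a : R₁ a = R a := by simp [hR₁, haF]
  have h2 : Runs (pop a (push a true ;; push F true) (push a false) (push F true)) R₁
      (Function.update R F (flag (canonTop (R a)))) 4 := by
    rcases hRa : R a with _ | ⟨b, w⟩
    · refine (Runs.pop_nil _ _ (by rw [hR₁a, hRa]) (Runs.push' ?_)).mono (by omega)
      simp [hR₁, canonTop]
    · have hback : Function.update (Function.update R₁ a w) a (b :: Function.update R₁ a w a) = R₁ := by
        rw [Function.update_self, Function.update_idem, ← hRa, ← hR₁a, Function.update_eq_self]
      cases b
      · refine (Runs.pop_false _ _ (by rw [hR₁a, hRa]) (Runs.push' ?_)).mono (by omega)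
        rw [hback, hR₁]
        simp [canonTop]
      · refine (Runs.pop_true _ _ (by rw [hR₁a, hRa]) ((Runs.push' hback).seq (Runs.push' ?_))).mono
          (by omega)
        rw [hR₁]
        simp [canonTop]
  exact (h1.seq h2).mono (by omega)

/-- `peekTwo a F`: set the flag `F` to "`a` holds at least two bits" by peeking at the top two
bits of `a` (restoring them). [folklore] -/
def peekTwo (a F : ι) : Com ι :=
  clear F ;;
  pop a
    (pop a (push a true ;; push a true ;; push F true) (push a false ;; push a true ;; push F true)
      (push a true))
    (pop a (push a true ;; push a false ;; push F true) (push a false ;; push a false ;; push F true)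
      (push a false))
    skip

/-- `peekTwo` decides `2 ≤ |a|` in `10` steps. [folklore] -/
theorem runs_peekTwo {a F : ι} (haF : a ≠ F) (R : Regs ι) (hF : (R F).length ≤ 1) :
    Runs (peekTwo a F) R (Function.update R F (flag (decide (2 ≤ (R a).length)))) 10 := by
  have h1 := runs_clear_flag F hF
  set R₁ := Function.update R F [] with hR₁
  have hR₁a : R₁ a = R a := by simp [hR₁, haF]
  have hfin : ∀ (b b' : Bool) (w : List Bool), R a = b :: b' :: w →
      Function.update (Function.update (Function.update (Function.update R₁ a w) a
        (b' :: w)) a (b :: b' :: w)) F (true :: (Function.update (Function.update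
          (Function.update R₁ a w) a (b' :: w)) a (b :: b' :: w)) F) =
      Function.update R F (flag (decide (2 ≤ (R a).length))) := by
    intro b b' w hRa
    rw [Function.update_idem, Function.update_idem, ← hRa, ← hR₁a, Function.update_eq_self, hR₁a,
      hRa, hR₁]
    simp
  have h2 : Runs (pop a
      (pop a (push a true ;; push a true ;; push F true) (push a false ;; push a true ;; push F true)
        (push a true))
      (pop a (push a true ;; push a false ;; push F true) (push a false ;; push a false ;; push F true)
        (push a false))
      skip) R₁ (Function.update R F (flag (decide (2 ≤ (R a).length)))) 7 := by
    obtain ⟨l, hRa⟩ : ∃ l, R a = l := ⟨_, rfl⟩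
    rcases l with _ | ⟨b, w⟩
    · refine (Runs.pop_nil _ _ (by rw [hR₁a, hRa]) (Runs.skip _)).of_eq ?_ (by omega)
      rw [hR₁, hRa]; simp
    · have hk : R₁ a = b :: w := by rw [hR₁a, hRa]
      rcases w with _ | ⟨b', w⟩
      · have hnil : Function.update R₁ a ([] : List Bool) a = [] := by simp
        have hpush : ∀ c : Bool, Runs (push a c) (Function.update R₁ a [])
            (Function.update (Function.update R₁ a []) a [c]) 1 := fun c =>
          Runs.push' (by simp)
        have hfile : Function.update (Function.update R₁ a []) a [b] =
            Function.update R F (flag (decide (2 ≤ (R a).length))) := by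
          rw [Function.update_idem, ← hk, Function.update_eq_self, hRa, hR₁]
          simp
        cases b
        · have hin : Runs _ (Function.update R₁ a []) _ 3 :=
            Runs.pop_nil (push a true ;; push a false ;; push F true)
              (push a false ;; push a false ;; push F true) hnil ((hpush false).congr hfile)
          exact (Runs.pop_false _ _ hk hin).of_eq rfl (by omega)
        · have hin : Runs _ (Function.update R₁ a []) _ 3 :=
            Runs.pop_nil (push a true ;; push a true ;; push F true)
              (push a false ;; push a true ;; push F true) hnil ((hpush true).congr hfile)
          exact (Runs.pop_true _ _ hk hin).of_eq rfl (by omega)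
      · have hk' : Function.update R₁ a (b' :: w) a = b' :: w := by simp
        have h3 : ∀ b b' : Bool, R a = b :: b' :: w →
            Runs (push a b' ;; push a b ;; push F true) (Function.update (Function.update R₁ a
              (b' :: w)) a w) (Function.update R F (flag (decide (2 ≤ (R a).length)))) 3 := by
          intro b b' hRa
          refine ((Runs.push' rfl).seq ((Runs.push' rfl).seq (Runs.push' ?_))).of_eq rfl (by omega)
          rw [← hfin b b' w hRa]
          simp
        cases b <;> cases b'
        · have hin : Runs _ (Function.update R₁ a (false :: w)) _ 5 :=
            Runs.pop_false (push a true ;; push a false ;; push F true) (push a false) hk'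
              (h3 false false hRa)
          exact (Runs.pop_false _ _ hk hin).of_eq rfl (by omega)
        · have hin : Runs _ (Function.update R₁ a (true :: w)) _ 5 :=
            Runs.pop_true (push a false ;; push a false ;; push F true) (push a false) hk'
              (h3 false true hRa)
          exact (Runs.pop_false _ _ hk hin).of_eq rfl (by omega)
        · have hin : Runs _ (Function.update R₁ a (false :: w)) _ 5 :=
            Runs.pop_false (push a true ;; push a true ;; push F true) (push a true) hk'
              (h3 true false hRa)
          exact (Runs.pop_true _ _ hk hin).of_eq rfl (by omega)
        · have hin : Runs _ (Function.update R₁ a (true :: w)) _ 5 :=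
            Runs.pop_true (push a false ;; push a true ;; push F true) (push a true) hk'
              (h3 true true hRa)
          exact (Runs.pop_true _ _ hk hin).of_eq rfl (by omega)
  exact (h1.seq h2).mono (by omega)

/-- `andFlag F G`: the conjunction `F := F ∧ G` of two flag registers (keeping `G`).
[folklore] -/
def andFlag (F G : ι) : Com ι := ifFlag G skip (clear F)

/-- `andFlag` computes the conjunction in `6` steps. [folklore] -/
theorem runs_andFlag (F G : ι) (R : Regs ι) (b c : Bool) (hF : R F = flag b)
    (hG : R G = flag c) : Runs (andFlag F G) R (Function.update R F (flag (b && c))) 6 := by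
  refine runs_ifFlag (B := 3) hG (fun hc => ?_) (fun hc => ?_)
  · subst hc
    refine (Runs.skip R).of_eq ?_ (by omega)
    rw [Bool.and_true, ← hF, Function.update_eq_self]
  · subst hc
    refine (runs_clear_flag F (by rw [hF]; exact length_flag_le b)).of_eq ?_ le_rfl
    rw [Bool.and_false, flag_false]

end Com

end Literature.Computability.Complexity
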